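import Mathlib.NumberTheory.LSeries.Dirichlet
import Mathlib.RingTheory.PowerSeries.Basic
import Mathlib.Algebra.GCDMonoid.Nat
import Mathlib.Data.Nat.Sqrt
import HarnessLib

/-!
# Rankin's factorisation `∑ a(n) σ_χ(n) n⁻ˢ · L(χν, 2s) = L(a, s) · L(a ⊗ χ, s)`

Topic `Literature/NumberTheory/LFunctions`; namespace
`Literature.NumberTheory.LFunctions.RankinEisenstein` (grouping sub-namespace for this identity; the
squares re-indexing `alongSquares` here carries no extra factor `n`, unlike
`Literature.NumberTheory.EllipticCurves.ModularForms.onSquares`).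
Everything here is proved; no named facts are introduced.

Let `a : ℕ → ℂ` be multiplicative with a **degree-two Hecke recursion** at every prime,
`a(p^{k+2}) = a(p) a(p^{k+1}) - ν(p) a(p^k)` with `ν` completely multiplicative (for the Fourier
coefficients of a normalised Hecke eigenform of weight `k` and level `N`: `ν(p) = p^{k-1}` for
`p ∤ N` and `ν(p) = 0` for `p ∣ N`; for an elliptic curve over `ℚ`: `ν(p) = p` at good primes, `0`
at bad ones), and let `χ` be completely multiplicative (a Dirichlet character). Write
`σ_χ(n) = ∑_{d ∣ n} χ(d)` (`twistedDivisorSum`) — the `n`-th Fourier coefficient of the weight-one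
Eisenstein series `E₁(𝟙, χ)`, and of one half of the class group theta series
`∑_{A ∈ Cl(D)} θ_A` when `χ = χ_D`, `D < -4` fundamental (Dirichlet) — and `sq(g)(m) = g(√m)` on
squares, `0` elsewhere (`alongSquares`). Then, as arithmetic functions (Dirichlet convolution `⍟`),

  `(a · σ_χ) ⍟ sq(χν) = a ⍟ (a · χ)`        (`convolution_mul_twistedDivisorSum_alongSquares`)

and hence, wherever the four Dirichlet series converge absolutely,

  `(∑ a(n) σ_χ(n) n⁻ˢ) · L(χν, 2s) = L(a, s) · L(a·χ, s)`   (`LSeries_mul_twistedDivisorSum`),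

with `L(sq g, s) = L(g, 2s)` (`LSeries_alongSquares`). For `ν(n) = n` on `(n, N) = 1` the middle
factor is `L_N(χ, 2s - 1)`: this is the classical first step of every Rankin–Selberg unfolding of a
weight-two cusp form against a weight-one theta/Eisenstein series,
`∑ a(n) r_χ(n) n⁻ˢ = L(f, s) L(f ⊗ χ, s) / L_N(χ, 2s - 1)` (Rankin 1939; Shimura 1976, Lemma 1, the
case where the second form is an Eisenstein series; Gross 1987, §§4–5 with the `r_𝒜`), needed e.g.
for Tunnell's curve `y² = x³ - x`, `χ = χ_{-8n}`, in the
`Literature.NumberTheory.EllipticCurves.Tunnell1983` cluster.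

## Proof

Both sides of the convolution identity are multiplicative, so it suffices to compare them on prime
powers, where with `A_k = a(p^k)`, `c = χ(p)`, `m = ν(p)` it is the identity of formal power series
`(∑ A_k (1 + c + ⋯ + c^k) X^k) · (1 - c m X²)⁻¹ = (∑ A_k X^k)(∑ c^k A_k X^k)`, i.e. (multiplying by
`P(X) P_c(X)`, `P = 1 - A₁ X + m X²`, `P_c = 1 - A₁ c X + m c² X²`, `(∑ A_k X^k) P = 1`,
`(∑ c^k A_k X^k) P_c = 1`)
`(∑ A_k (1 + ⋯ + c^k) X^k) · P · P_c = 1 - c m X²` — a finite check on the coefficients of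
`X⁰, …, X³` and a five-term linear recurrence for the higher ones
(`mk_geom_mul_quadratic_mul_quadratic`).

## References

* R. A. Rankin, *Contributions to the theory of Ramanujan's function τ(n) and similar arithmetical
  functions II*, Proc. Cambridge Philos. Soc. 35 (1939), 357–372.
* G. Shimura, *The special values of the zeta functions associated with cusp forms*, Comm. Pure
  Appl. Math. 29 (1976), 783–804, Lemma 1.
* B. H. Gross, *Heights and the special values of L-series*, CMS Conf. Proc. 7 (1987), 115–187,
  §§4–5.
-/

noncomputable section

open Finset PowerSeries

namespace Literature.NumberTheory.LFunctions

/-! ### The local computation: formal power series in one variable -/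

namespace RankinEisenstein

variable {R : Type*} [CommRing R]

/-- `[X^n] (r · (∑ f_k X^k) · X^j) = r f_{n-j}` for `j ≤ n`, and `0` otherwise. [folklore] -/
theorem coeff_C_mul_mk_mul_X_pow (r : R) (f : ℕ → R) (j n : ℕ) :
    coeff n (C r * (PowerSeries.mk f * X ^ j)) = if j ≤ n then r * f (n - j) else 0 := by
  rw [coeff_C_mul, coeff_mul_X_pow']
  split_ifs with h
  · rw [coeff_mk]
  · rw [mul_zero]

/-- If `B 0 = 1`, `B 1 = l` and `B (k+2) = l B(k+1) - q B k`, then `(∑ B_k X^k)(1 - lX + qX²) = 1`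
(the degree-two Euler factor as a formal power series). [folklore] -/
theorem mk_mul_quadratic_eq_one (B : ℕ → R) (l q : R) (h0 : B 0 = 1) (h1 : B 1 = l)
    (hrec : ∀ k, B (k + 2) = l * B (k + 1) - q * B k) :
    PowerSeries.mk B * (1 - C l * X + C q * X ^ 2) = 1 := by
  have hexp : PowerSeries.mk B * (1 - C l * X + C q * X ^ 2)
      = PowerSeries.mk B + C (-l) * (PowerSeries.mk B * X ^ 1)
          + C q * (PowerSeries.mk B * X ^ 2) := by
    simp only [map_neg]
    ring
  rw [hexp]
  ext n
  rw [map_add, map_add, coeff_C_mul_mk_mul_X_pow, coeff_C_mul_mk_mul_X_pow, coeff_mk, coeff_one]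
  rcases lt_or_ge n 2 with hn | hn
  · interval_cases n
    · norm_num [h0]
    · norm_num [h0, h1]
  · obtain ⟨k, rfl⟩ := Nat.exists_eq_add_of_le' hn
    rw [if_pos (show 1 ≤ k + 2 by omega), if_pos (show 2 ≤ k + 2 by omega),
      if_neg (show k + 2 ≠ 0 by omega), show k + 2 - 1 = k + 1 by omega,
      show k + 2 - 2 = k by omega, hrec k]
    ring

/-- `(∑_{j even} q^{j/2} X^j)(1 - q X²) = 1`. [folklore] -/
theorem mk_sq_mul_eq_one (q : R) :
    PowerSeries.mk (fun j ↦ if Even j then q ^ (j / 2) else 0) * (1 - C q * X ^ 2) = 1 := by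
  set F : ℕ → R := fun j ↦ if Even j then q ^ (j / 2) else 0 with hF
  have hexp : PowerSeries.mk F * (1 - C q * X ^ 2)
      = PowerSeries.mk F + C (-q) * (PowerSeries.mk F * X ^ 2) := by
    simp only [map_neg]
    ring
  rw [hexp]
  ext n
  rw [map_add, coeff_C_mul_mk_mul_X_pow, coeff_mk, coeff_one]
  rcases lt_or_ge n 2 with hn | hn
  · interval_cases n
    · norm_num [hF]
    · norm_num [hF]
  · obtain ⟨k, rfl⟩ := Nat.exists_eq_add_of_le' hn
    rw [if_pos (show 2 ≤ k + 2 by omega), if_neg (show k + 2 ≠ 0 by omega),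
      show k + 2 - 2 = k by omega]
    simp only [hF]
    by_cases hk : Even k
    · have hk2 : Even (k + 2) := by simpa [Nat.even_add] using hk
      rw [if_pos hk2, if_pos hk, Nat.add_div_right k (by norm_num : 0 < 2), pow_succ]
      ring
    · have hk2 : ¬ Even (k + 2) := by simpa [Nat.even_add] using hk
      rw [if_neg hk2, if_neg hk]
      ring

/-- **The key local identity.** If `A 0 = 1` and `A (k+2) = A 1 · A (k+1) - m · A k`, then with
`G_k = 1 + c + ⋯ + c^k`,
`(∑ A_k G_k X^k) · (1 - A₁ X + m X²) · (1 - A₁ c X + m c² X²) = 1 - c m X²`. [folklore] -/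
theorem mk_geom_mul_quadratic_mul_quadratic (A : ℕ → R) (c m : R) (hA0 : A 0 = 1)
    (hA : ∀ k, A (k + 2) = A 1 * A (k + 1) - m * A k) :
    PowerSeries.mk (fun i ↦ A i * ∑ t ∈ range (i + 1), c ^ t) *
        (1 - C (A 1) * X + C m * X ^ 2) * (1 - C (A 1 * c) * X + C (m * c ^ 2) * X ^ 2)
      = 1 - C (c * m) * X ^ 2 := by
  set l := A 1 with hl
  set G : ℕ → R := fun i ↦ ∑ t ∈ range (i + 1), c ^ t with hG
  have hG0 : G 0 = 1 := by simp [hG]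
  have hGs : ∀ i, G (i + 1) = G i + c ^ (i + 1) := fun i ↦ by
    simp only [hG]
    rw [Finset.sum_range_succ]
  set F : ℕ → R := fun i ↦ A i * G i with hF
  -- the four small coefficients
  have hA2 : A 2 = l * l - m := by rw [hA 0, hA0, ← hl]; ring
  have hA3 : A 3 = l * (l * l - m) - m * l := by rw [hA 1, hA2, ← hl]
  have cf0 : F 0 = 1 := by simp [hF, hA0, hG0]
  have cf1 : F 1 = l * (1 + c) := by
    rw [hF]; simp only [← hl, hGs 0, hG0]; ring
  have cf2 : F 2 = (l * l - m) * (1 + c + c ^ 2) := by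
    rw [hF]; simp only [hA2, hGs 1, hGs 0, hG0]; ring
  have cf3 : F 3 = (l * (l * l - m) - m * l) * (1 + c + c ^ 2 + c ^ 3) := by
    rw [hF]; simp only [hA3, hGs 2, hGs 1, hGs 0, hG0]; ring
  have hexp : PowerSeries.mk F * (1 - C l * X + C m * X ^ 2)
        * (1 - C (l * c) * X + C (m * c ^ 2) * X ^ 2)
      = PowerSeries.mk F + C (-(l * (1 + c))) * (PowerSeries.mk F * X ^ 1)
          + C (m * (1 + c ^ 2) + l ^ 2 * c) * (PowerSeries.mk F * X ^ 2)
          + C (-(l * m * c * (1 + c))) * (PowerSeries.mk F * X ^ 3)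
          + C (m ^ 2 * c ^ 2) * (PowerSeries.mk F * X ^ 4) := by
    simp only [map_neg, map_add, map_mul, map_pow, map_one]
    ring
  rw [hexp]
  ext n
  rw [map_add, map_add, map_add, map_add, coeff_C_mul_mk_mul_X_pow, coeff_C_mul_mk_mul_X_pow,
    coeff_C_mul_mk_mul_X_pow, coeff_C_mul_mk_mul_X_pow, coeff_mk, map_sub, coeff_one,
    coeff_C_mul, coeff_X_pow]
  rcases lt_or_ge n 4 with hn | hn
  · interval_cases n
    · norm_num [cf0]
    · norm_num [cf0, cf1]
    · norm_num [cf0, cf1, cf2]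
      ring
    · norm_num [cf0, cf1, cf2, cf3]
      ring
  · obtain ⟨k, rfl⟩ := Nat.exists_eq_add_of_le' hn
    rw [if_pos (show 1 ≤ k + 4 by omega), if_pos (show 2 ≤ k + 4 by omega),
      if_pos (show 3 ≤ k + 4 by omega), if_pos (show 4 ≤ k + 4 by omega),
      if_neg (show k + 4 ≠ 0 by omega), if_neg (show k + 4 ≠ 2 by omega),
      show k + 4 - 1 = k + 3 by omega, show k + 4 - 2 = k + 2 by omega,
      show k + 4 - 3 = k + 1 by omega, show k + 4 - 4 = k by omega]
    simp only [hF]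
    have hA2' : A (k + 2) = l * A (k + 1) - m * A k := hA k
    have hA3' : A (k + 3) = l * A (k + 2) - m * A (k + 1) := hA (k + 1)
    have hA4' : A (k + 4) = l * A (k + 3) - m * A (k + 2) := hA (k + 2)
    have hG1' : G (k + 1) = G k + c ^ (k + 1) := hGs k
    have hG2' : G (k + 2) = G (k + 1) + c ^ (k + 2) := hGs (k + 1)
    have hG3' : G (k + 3) = G (k + 2) + c ^ (k + 3) := hGs (k + 2)
    have hG4' : G (k + 4) = G (k + 3) + c ^ (k + 4) := hGs (k + 3)
    rw [hA4', hA3', hA2', hG4', hG3', hG2', hG1']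
    ring

/-- **The local identity on coefficients**: with `A 0 = 1`, `A (k+2) = A 1 · A(k+1) - m · A k`,
`G_i = 1 + c + ⋯ + c^i` and `S_j = (cm)^{j/2}` for even `j`, `0` for odd `j`,
`∑_{i ≤ k} A_i G_i S_{k-i} = ∑_{i ≤ k} A_i · c^{k-i} A_{k-i}` (compare the coefficients of `X^k` in
`(∑ A_i G_i X^i)(1 - cmX²)⁻¹ = (∑ A_i X^i)(∑ c^i A_i X^i)`). [folklore] -/
theorem sum_range_mul_geom_mul_sq (A : ℕ → R) (c m : R) (hA0 : A 0 = 1)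
    (hA : ∀ k, A (k + 2) = A 1 * A (k + 1) - m * A k) (k : ℕ) :
    ∑ i ∈ range (k + 1), (A i * ∑ t ∈ range (i + 1), c ^ t) *
        (if Even (k - i) then (c * m) ^ ((k - i) / 2) else 0)
      = ∑ i ∈ range (k + 1), A i * (c ^ (k - i) * A (k - i)) := by
  set M : PowerSeries R := PowerSeries.mk (fun i ↦ A i * ∑ t ∈ range (i + 1), c ^ t) with hM
  set S : PowerSeries R := PowerSeries.mk (fun j ↦ if Even j then (c * m) ^ (j / 2) else 0) with hS
  set PA : PowerSeries R := PowerSeries.mk A with hPA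
  set PAc : PowerSeries R := PowerSeries.mk (fun i ↦ c ^ i * A i) with hPAc
  set P : PowerSeries R := 1 - C (A 1) * X + C m * X ^ 2 with hP
  set Pc : PowerSeries R := 1 - C (A 1 * c) * X + C (m * c ^ 2) * X ^ 2 with hPc
  set D : PowerSeries R := 1 - C (c * m) * X ^ 2 with hD
  have h1 : PA * P = 1 := mk_mul_quadratic_eq_one A (A 1) m hA0 rfl hA
  have h2 : PAc * Pc = 1 := by
    refine mk_mul_quadratic_eq_one (fun i ↦ c ^ i * A i) (A 1 * c) (m * c ^ 2) ?_ ?_ ?_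
    · simp only [pow_zero, hA0, mul_one]
    · simp only [pow_one, mul_comm]
    · intro j
      rw [hA j]
      ring
  have h3 : S * D = 1 := mk_sq_mul_eq_one (c * m)
  have h4 : M * P * Pc = D := mk_geom_mul_quadratic_mul_quadratic A c m hA0 hA
  have key : M * S = PA * PAc := by
    calc M * S = M * S * ((PA * P) * (PAc * Pc)) := by rw [h1, h2, mul_one, mul_one]
      _ = (M * P * Pc) * S * PA * PAc := by ring
      _ = (S * D) * PA * PAc := by rw [h4]; ring
      _ = PA * PAc := by rw [h3, one_mul]
  have hk := congrArg (coeff k) key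
  rw [coeff_mul, coeff_mul, Finset.Nat.sum_antidiagonal_eq_sum_range_succ_mk,
    Finset.Nat.sum_antidiagonal_eq_sum_range_succ_mk] at hk
  simpa [hM, hS, hPA, hPAc, coeff_mk] using hk

/-! ### Twisted divisor sums and functions supported on squares -/

/-- The **twisted divisor sum** `σ_χ(n) = ∑_{d ∣ n} χ(d)` (`σ_χ(0) = 0`): for a Dirichlet character
`χ` the `n`-th coefficient (`n ≥ 1`) of the weight-one Eisenstein series `E₁(𝟙, χ)`, and for
`χ = χ_D`, `D < -4` a fundamental discriminant, one half of `∑_{A ∈ Cl(D)} r_A(n)` (Dirichlet).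
[folklore] -/
def twistedDivisorSum (χ : ℕ → ℂ) : ℕ → ℂ := fun n ↦ ∑ d ∈ n.divisors, χ d

/-- The function `m ↦ g(√m)` on perfect squares, `0` elsewhere: its Dirichlet series is `L(g, 2s)`
(`LSeries_alongSquares`). [folklore] -/
def alongSquares (g : ℕ → ℂ) : ℕ → ℂ := fun m ↦ if IsSquare m then g m.sqrt else 0

/-- Unfolding `twistedDivisorSum`. [folklore] -/
theorem twistedDivisorSum_apply (χ : ℕ → ℂ) (n : ℕ) :
    twistedDivisorSum χ n = ∑ d ∈ n.divisors, χ d := rfl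

/-- `σ_χ(0) = 0`. [folklore] -/
@[simp] theorem twistedDivisorSum_zero (χ : ℕ → ℂ) : twistedDivisorSum χ 0 = 0 := by
  simp [twistedDivisorSum]

/-- `sq(g)(k²) = g(k)`. [folklore] -/
theorem alongSquares_mul_self (g : ℕ → ℂ) (k : ℕ) : alongSquares g (k * k) = g k := by
  have hk : IsSquare (k * k) := ⟨k, rfl⟩
  simp [alongSquares, hk, Nat.sqrt_eq]

/-- `sq(g)(m) = 0` off the squares. [folklore] -/
theorem alongSquares_of_not_isSquare (g : ℕ → ℂ) {m : ℕ} (hm : ¬ IsSquare m) :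
    alongSquares g m = 0 := by
  simp [alongSquares, hm]

/-- `χ(p^t) = χ(p)^t` for a completely multiplicative `χ` with `χ 1 = 1`. [folklore] -/
theorem apply_prime_pow_of_mul {χ : ℕ → ℂ} (hχ1 : χ 1 = 1) (hχ : ∀ m n, χ (m * n) = χ m * χ n)
    (p t : ℕ) : χ (p ^ t) = χ p ^ t := by
  induction t with
  | zero => simpa using hχ1
  | succ t ih => rw [pow_succ, hχ, ih, pow_succ]

/-- `σ_χ(p^i) = 1 + χ(p) + ⋯ + χ(p)^i`. [folklore] -/
theorem twistedDivisorSum_prime_pow {χ : ℕ → ℂ} (hχ1 : χ 1 = 1)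
    (hχ : ∀ m n, χ (m * n) = χ m * χ n) {p : ℕ} (hp : p.Prime) (i : ℕ) :
    twistedDivisorSum χ (p ^ i) = ∑ t ∈ range (i + 1), χ p ^ t := by
  rw [twistedDivisorSum_apply, Nat.sum_divisors_prime_pow hp]
  exact Finset.sum_congr rfl fun t _ ↦ apply_prime_pow_of_mul hχ1 hχ p t

/-- A prime power `p^j` is a square iff `j` is even. [folklore] -/
theorem isSquare_prime_pow_iff {p : ℕ} (hp : p.Prime) (j : ℕ) : IsSquare (p ^ j) ↔ Even j := by
  constructor
  · rintro ⟨r, hr⟩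
    have hdvd : r ∣ p ^ j := ⟨r, hr⟩
    obtain ⟨i, -, rfl⟩ := (Nat.dvd_prime_pow hp).mp hdvd
    rw [← pow_add] at hr
    exact ⟨i, Nat.pow_right_injective hp.two_le hr⟩
  · rintro ⟨i, rfl⟩
    exact ⟨p ^ i, by rw [pow_add]⟩

/-- `sq(g)(p^j) = (g p)^{j/2}` for even `j` and `0` for odd `j`, when `g` is completely
multiplicative with `g 1 = 1`. [folklore] -/
theorem alongSquares_prime_pow {g : ℕ → ℂ} (hg1 : g 1 = 1) (hg : ∀ m n, g (m * n) = g m * g n)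
    {p : ℕ} (hp : p.Prime) (j : ℕ) :
    alongSquares g (p ^ j) = if Even j then g p ^ (j / 2) else 0 := by
  by_cases hj : Even j
  · obtain ⟨i, rfl⟩ := hj
    rw [if_pos ⟨i, rfl⟩, pow_add, alongSquares_mul_self, apply_prime_pow_of_mul hg1 hg,
      show (i + i) / 2 = i by omega]
  · rw [if_neg hj, alongSquares_of_not_isSquare]
    rwa [isSquare_prime_pow_iff hp]

/-- For coprime `m, n`: `mn` is a square iff both `m` and `n` are. [folklore] -/
theorem isSquare_mul_iff_of_coprime {m n : ℕ} (hmn : m.Coprime n) :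
    IsSquare (m * n) ↔ IsSquare m ∧ IsSquare n := by
  refine ⟨fun ⟨r, hr⟩ ↦ ?_, fun ⟨⟨d, hd⟩, ⟨e, he⟩⟩ ↦ ⟨d * e, by rw [hd, he]; ring⟩⟩
  have hu : IsUnit (gcd m n) := by
    rw [Nat.isUnit_iff]
    exact hmn
  have hu' : IsUnit (gcd n m) := by
    rw [Nat.isUnit_iff]
    exact hmn.symm
  have hr2 : m * n = r ^ 2 := by rw [hr, sq]
  have hr2' : n * m = r ^ 2 := by rw [mul_comm, hr2]
  obtain ⟨d, hd⟩ := exists_eq_pow_of_mul_eq_pow hu hr2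
  obtain ⟨e, he⟩ := exists_eq_pow_of_mul_eq_pow hu' hr2'
  exact ⟨⟨d, by rw [hd, sq]⟩, ⟨e, by rw [he, sq]⟩⟩

/-- `sq(g)` is multiplicative (as an arithmetic function) when `g` is completely multiplicative
with `g 1 = 1`. [folklore] -/
theorem isMultiplicative_alongSquares {g : ℕ → ℂ} (hg1 : g 1 = 1)
    (hg : ∀ m n, g (m * n) = g m * g n) :
    (toArithmeticFunction (alongSquares g)).IsMultiplicative := by
  refine ArithmeticFunction.IsMultiplicative.iff_ne_zero.mpr ⟨?_, fun {m} {n} hm hn hmn ↦ ?_⟩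
  · have h1 : alongSquares g 1 = 1 := by simpa [hg1] using alongSquares_mul_self g 1
    simp [toArithmeticFunction, h1]
  · simp only [toArithmeticFunction, ArithmeticFunction.coe_mk, mul_ne_zero hm hn, hm, hn, if_false]
    by_cases h : IsSquare m ∧ IsSquare n
    · obtain ⟨⟨d, rfl⟩, ⟨e, rfl⟩⟩ := h
      rw [show d * d * (e * e) = (d * e) * (d * e) by ring, alongSquares_mul_self,
        alongSquares_mul_self, alongSquares_mul_self, hg]
    · have hmn' : ¬ IsSquare (m * n) := by rwa [isSquare_mul_iff_of_coprime hmn]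
      rw [alongSquares_of_not_isSquare g hmn']
      rcases not_and_or.mp h with h' | h'
      · rw [alongSquares_of_not_isSquare g h', zero_mul]
      · rw [alongSquares_of_not_isSquare g h', mul_zero]

/-- A completely multiplicative `χ` with `χ 1 = 1` is multiplicative as an arithmetic function.
[folklore] -/
theorem isMultiplicative_toArithmeticFunction_of_mul {χ : ℕ → ℂ} (hχ1 : χ 1 = 1)
    (hχ : ∀ m n, χ (m * n) = χ m * χ n) :
    (toArithmeticFunction χ).IsMultiplicative := by
  refine ArithmeticFunction.IsMultiplicative.iff_ne_zero.mpr ⟨?_, fun {m} {n} hm hn _ ↦ ?_⟩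
  · simp [toArithmeticFunction, hχ1]
  · simp [toArithmeticFunction, hm, hn, hχ]

/-- The Dirichlet convolution of two arithmetic functions at a prime power:
`(F * G)(p^k) = ∑_{i ≤ k} F(p^i) G(p^{k-i})`. [folklore] -/
theorem mul_apply_prime_pow {S : Type*} [CommSemiring S]
    (F G : ArithmeticFunction S) {p : ℕ} (hp : p.Prime) (k : ℕ) :
    (F * G) (p ^ k) = ∑ i ∈ range (k + 1), F (p ^ i) * G (p ^ (k - i)) := by
  rw [ArithmeticFunction.mul_apply]
  refine (Nat.sum_divisorsAntidiagonal (fun x y ↦ F x * G y)).trans ?_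
  rw [Nat.sum_divisors_prime_pow hp]
  refine Finset.sum_congr rfl fun i hi ↦ ?_
  rw [Nat.pow_div (Finset.mem_range_succ_iff.mp hi) hp.pos]

/-! ### The global identities -/

section Global

variable (a : ArithmeticFunction ℂ) (χ ν : ℕ → ℂ)

/-- `a · σ_χ` is the arithmetic function `a ⊙ (ζ * χ)` (pointwise product with a Dirichlet
convolution). [folklore] -/
theorem toArithmeticFunction_mul_twistedDivisorSum :
    toArithmeticFunction (⇑a * twistedDivisorSum χ)
      = a.pmul ((ArithmeticFunction.zeta : ArithmeticFunction ℂ) * toArithmeticFunction χ) := by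
  ext n
  rcases eq_or_ne n 0 with rfl | hn
  · simp [toArithmeticFunction]
  · simp only [toArithmeticFunction, ArithmeticFunction.coe_mk, hn, if_false, Pi.mul_apply,
      ArithmeticFunction.pmul_apply, ArithmeticFunction.coe_zeta_mul_apply, twistedDivisorSum_apply]
    congr 1
    refine Finset.sum_congr rfl fun d hd ↦ ?_
    rw [if_neg (Nat.pos_of_mem_divisors hd).ne']

/-- `a · χ` is the arithmetic function `a ⊙ χ`. [folklore] -/
theorem toArithmeticFunction_mul_eq_pmul :
    toArithmeticFunction (⇑a * χ) = a.pmul (toArithmeticFunction χ) := by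
  ext n
  rcases eq_or_ne n 0 with rfl | hn
  · simp [toArithmeticFunction]
  · simp [toArithmeticFunction, hn, ArithmeticFunction.pmul_apply]

variable {a χ ν}

/-- **Rankin's factorisation, arithmetic form.** For `a` multiplicative with the degree-two
recursion `a(p^{k+2}) = a(p) a(p^{k+1}) - ν(p) a(p^k)` at every prime and `χ, ν` completely
multiplicative: `(a · σ_χ) ⍟ sq(χν) = a ⍟ (a · χ)` (Rankin 1939; Shimura 1976, Lemma 1 with an
Eisenstein series as second factor). [folklore] -/
theorem convolution_mul_twistedDivisorSum_alongSquares (ha : a.IsMultiplicative)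
    (hrec : ∀ p : ℕ, p.Prime → ∀ k : ℕ, a (p ^ (k + 2)) = a p * a (p ^ (k + 1)) - ν p * a (p ^ k))
    (hχ1 : χ 1 = 1) (hχ : ∀ m n, χ (m * n) = χ m * χ n)
    (hν1 : ν 1 = 1) (hν : ∀ m n, ν (m * n) = ν m * ν n) :
    LSeries.convolution (⇑a * twistedDivisorSum χ) (alongSquares (χ * ν))
      = LSeries.convolution ⇑a (⇑a * χ) := by
  have hg1 : (χ * ν) 1 = 1 := by simp [hχ1, hν1]
  have hg : ∀ m n, (χ * ν) (m * n) = (χ * ν) m * (χ * ν) n := fun m n ↦ by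
    simp only [Pi.mul_apply, hχ, hν]; ring
  have hΧ := isMultiplicative_toArithmeticFunction_of_mul hχ1 hχ
  have hF₁ : (toArithmeticFunction (⇑a * twistedDivisorSum χ)).IsMultiplicative := by
    rw [toArithmeticFunction_mul_twistedDivisorSum]
    exact ha.pmul (ArithmeticFunction.isMultiplicative_zeta.natCast.mul hΧ)
  have hG₁ := isMultiplicative_alongSquares hg1 hg
  have hF₂ : (toArithmeticFunction (⇑a : ℕ → ℂ)).IsMultiplicative := by
    rwa [ArithmeticFunction.toArithmeticFunction_eq_self]
  have hG₂ : (toArithmeticFunction (⇑a * χ)).IsMultiplicative := by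
    rw [toArithmeticFunction_mul_eq_pmul]
    exact ha.pmul hΧ
  unfold LSeries.convolution
  congr 1
  refine (ArithmeticFunction.IsMultiplicative.eq_iff_eq_on_prime_powers _ (hF₁.mul hG₁) _
    (hF₂.mul hG₂)).mpr fun p k hp ↦ ?_
  rw [mul_apply_prime_pow _ _ hp, mul_apply_prime_pow _ _ hp]
  have hp0 : ∀ i, p ^ i ≠ 0 := fun i ↦ pow_ne_zero i hp.ne_zero
  -- evaluate the four factors on prime powers
  have eF₁ : ∀ i, toArithmeticFunction (⇑a * twistedDivisorSum χ) (p ^ i)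
      = a (p ^ i) * ∑ t ∈ range (i + 1), χ p ^ t := fun i ↦ by
    simp only [toArithmeticFunction, ArithmeticFunction.coe_mk, hp0 i, if_false, Pi.mul_apply,
      twistedDivisorSum_prime_pow hχ1 hχ hp]
  have eG₁ : ∀ j, toArithmeticFunction (alongSquares (χ * ν)) (p ^ j)
      = if Even j then (χ p * ν p) ^ (j / 2) else 0 := fun j ↦ by
    simp only [toArithmeticFunction, ArithmeticFunction.coe_mk, hp0 j, if_false,
      alongSquares_prime_pow hg1 hg hp, Pi.mul_apply]
  have eF₂ : ∀ i, toArithmeticFunction (⇑a : ℕ → ℂ) (p ^ i) = a (p ^ i) := fun i ↦ by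
    simp only [toArithmeticFunction, ArithmeticFunction.coe_mk, hp0 i, if_false]
  have eG₂ : ∀ j, toArithmeticFunction (⇑a * χ) (p ^ j) = χ p ^ j * a (p ^ j) := fun j ↦ by
    simp only [toArithmeticFunction, ArithmeticFunction.coe_mk, hp0 j, if_false, Pi.mul_apply,
      apply_prime_pow_of_mul hχ1 hχ]
    ring
  simp only [eF₁, eG₁, eF₂, eG₂]
  -- the local identity
  have hA0 : a (p ^ 0) = 1 := by rw [pow_zero, ha.map_one]
  have hA : ∀ k, a (p ^ (k + 2)) = a (p ^ 1) * a (p ^ (k + 1)) - ν p * a (p ^ k) := fun k ↦ by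
    rw [pow_one]; exact hrec p hp k
  have key := sum_range_mul_geom_mul_sq (fun i ↦ a (p ^ i)) (χ p) (ν p) hA0 hA k
  simpa using key

/-- The terms of `L(sq g, s)` vanish off the squares. [folklore] -/
theorem term_alongSquares_eq_zero_of_not_mem_range (g : ℕ → ℂ) (s : ℂ) {m : ℕ}
    (hm : m ∉ Set.range fun k : ℕ ↦ k * k) : LSeries.term (alongSquares g) s m = 0 := by
  rcases eq_or_ne m 0 with rfl | hm0
  · exact LSeries.term_zero _ _
  · have hsq : ¬ IsSquare m := fun ⟨r, hr⟩ ↦ hm ⟨r, hr.symm⟩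
    rw [LSeries.term_of_ne_zero hm0, alongSquares_of_not_isSquare g hsq, zero_div]

/-- The terms of `L(sq g, s)` along the squares are the terms of `L(g, 2s)`. [folklore] -/
theorem term_alongSquares_mul_self (g : ℕ → ℂ) (s : ℂ) (k : ℕ) :
    LSeries.term (alongSquares g) s (k * k) = LSeries.term g (2 * s) k := by
  rcases eq_or_ne k 0 with rfl | hk
  · rw [mul_zero, LSeries.term_zero, LSeries.term_zero]
  · have hk' : (k : ℂ) ≠ 0 := Nat.cast_ne_zero.mpr hk
    rw [LSeries.term_of_ne_zero (mul_ne_zero hk hk), LSeries.term_of_ne_zero hk,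
      alongSquares_mul_self, Nat.cast_mul, Complex.natCast_mul_natCast_cpow, two_mul,
      Complex.cpow_add _ _ hk']

/-- `L(sq g, s) = L(g, 2s)`: the Dirichlet series of `m ↦ g(√m)𝟙_{□}(m)` (no convergence
hypothesis; both sides are the same sum re-indexed along `k ↦ k²`). [folklore] -/
theorem LSeries_alongSquares (g : ℕ → ℂ) (s : ℂ) :
    LSeries (alongSquares g) s = LSeries g (2 * s) := by
  have hinj : Function.Injective fun k : ℕ ↦ k * k := fun a b h ↦ Nat.mul_self_inj.mp h
  have hsupp : Function.support (LSeries.term (alongSquares g) s) ⊆ Set.range fun k : ℕ ↦ k * k :=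
    fun m hm ↦ by_contra fun hrange ↦ hm (term_alongSquares_eq_zero_of_not_mem_range g s hrange)
  unfold LSeries
  rw [← hinj.tsum_eq hsupp]
  exact tsum_congr fun k ↦ term_alongSquares_mul_self g s k

/-- `∑ |sq(g)(m) m⁻ˢ| < ∞ ↔ ∑ |g(k) k^{-2s}| < ∞`. [folklore] -/
theorem LSeriesSummable_alongSquares_iff (g : ℕ → ℂ) (s : ℂ) :
    LSeriesSummable (alongSquares g) s ↔ LSeriesSummable g (2 * s) := by
  have hinj : Function.Injective fun k : ℕ ↦ k * k := fun a b h ↦ Nat.mul_self_inj.mp h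
  have h0 : ∀ m ∉ Set.range (fun k : ℕ ↦ k * k), LSeries.term (alongSquares g) s m = 0 :=
    fun m hm ↦ term_alongSquares_eq_zero_of_not_mem_range g s hm
  unfold LSeriesSummable
  rw [← hinj.summable_iff h0]
  exact summable_congr fun k ↦ term_alongSquares_mul_self g s k

/-- **Rankin's factorisation, Dirichlet-series form.** Under the hypotheses of
`convolution_mul_twistedDivisorSum_alongSquares`, at every `s` where the four series converge
absolutely, `(∑ a(n) σ_χ(n) n⁻ˢ) · L(χν, 2s) = L(a, s) · L(a·χ, s)` (Rankin 1939; Shimura 1976,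
Lemma 1; Gross 1987, §4). [folklore] -/
theorem LSeries_mul_twistedDivisorSum (ha : a.IsMultiplicative)
    (hrec : ∀ p : ℕ, p.Prime → ∀ k : ℕ, a (p ^ (k + 2)) = a p * a (p ^ (k + 1)) - ν p * a (p ^ k))
    (hχ1 : χ 1 = 1) (hχ : ∀ m n, χ (m * n) = χ m * χ n)
    (hν1 : ν 1 = 1) (hν : ∀ m n, ν (m * n) = ν m * ν n) {s : ℂ}
    (h₁ : LSeriesSummable (⇑a * twistedDivisorSum χ) s) (h₂ : LSeriesSummable (χ * ν) (2 * s))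
    (h₃ : LSeriesSummable (⇑a : ℕ → ℂ) s) (h₄ : LSeriesSummable (⇑a * χ) s) :
    LSeries (⇑a * twistedDivisorSum χ) s * LSeries (χ * ν) (2 * s)
      = LSeries (⇑a : ℕ → ℂ) s * LSeries (⇑a * χ) s := by
  rw [← LSeries_alongSquares,
    ← LSeries_convolution' h₁ ((LSeriesSummable_alongSquares_iff _ _).mpr h₂),
    convolution_mul_twistedDivisorSum_alongSquares ha hrec hχ1 hχ hν1 hν,
    LSeries_convolution' h₃ h₄]

/-- The same for a **Dirichlet character** `χ` (complete multiplicativity being automatic).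
[folklore] -/
theorem LSeries_mul_twistedDivisorSum_dirichlet {M : ℕ} (χ' : DirichletCharacter ℂ M)
    (ha : a.IsMultiplicative)
    (hrec : ∀ p : ℕ, p.Prime → ∀ k : ℕ, a (p ^ (k + 2)) = a p * a (p ^ (k + 1)) - ν p * a (p ^ k))
    (hν1 : ν 1 = 1) (hν : ∀ m n, ν (m * n) = ν m * ν n) {s : ℂ}
    (h₁ : LSeriesSummable (⇑a * twistedDivisorSum (fun n : ℕ ↦ χ' n)) s)
    (h₂ : LSeriesSummable ((fun n : ℕ ↦ χ' n) * ν) (2 * s))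
    (h₃ : LSeriesSummable (⇑a : ℕ → ℂ) s) (h₄ : LSeriesSummable (⇑a * fun n : ℕ ↦ χ' n) s) :
    LSeries (⇑a * twistedDivisorSum (fun n : ℕ ↦ χ' n)) s * LSeries ((fun n : ℕ ↦ χ' n) * ν) (2 * s)
      = LSeries (⇑a : ℕ → ℂ) s * LSeries (⇑a * fun n : ℕ ↦ χ' n) s :=
  LSeries_mul_twistedDivisorSum ha hrec (by simp) (fun m n ↦ by simp [Nat.cast_mul]) hν1 hν
    h₁ h₂ h₃ h₄

end Global

end RankinEisenstein

end Literature.NumberTheory.LFunctions
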